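import Literature.Barriers.CriticalPhenomena.SupercriticalSAWSpaceFillingFamilies
import Literature.Probability.LatticeModels.LatticeAnimals
import HarnessLib

/-!
# Supercritical self-avoiding walks are space-filling (Duminil-Copin–Kozma–Yadin 2014):
# the dichotomy behind the Peierls sum, and the summation index

Fourth file of the proof of Theorem 6 of H. Duminil-Copin, G. Kozma, A. Yadin, *Supercritical
self-avoiding walks are space-filling*, Ann. IHP Probab. Stat. 50 (2014) 315–326
(arXiv:1110.3074) for `Ω = 𝔻` (`DKY2014_thm6_disk`; ingredients in `…Families.lean`).

* `good_or_bad_of_hasLargeHole` — **the geometric core**: from `HasLargeHole ξ(m) s γ`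
  (`ξ(m) = tubeRadius m`) and `0 < δ ≤ 1/(3N)²`, EITHER `γ` meets no deep box (the case the
  print omits: "Since the family of boxes is maximal, and because of the condition of the
  theorem that the family of all boxes is connected, the box-distance between the union of
  boxes and `γ_δ` is 1" presumes a touched box), OR there is a connected family `F` of deep
  boxes untouched by `γ` with `(7N)² |F| > s` (the printed "at least `s/(2m+1)²` boxes") and a
  box `B(z₀ + d) ∉ F` adjacent to some `B(z₀) ∈ F` and met by `γ` (box-distance `1`). Proof:
  the component of the hole boxes inside the untouched deep boxes; if it has no touched deep
  neighbour it is closed under deep neighbours, hence is the whole (connected) deep family.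
* sizes: `𝔻_δ`, and hence any hole, has `< (2⌈1/δ⌉+1)²` sites (`lt_of_hasLargeHole`); the
  connected families of `K` deep boxes through a given box (`famAt`, the summation index of the
  Peierls sum) number at most `25^{K-1}` (`card_famAt_le`: the lattice-animal bound
  `card_connectedFamily_le` with `Δ = 4`, for the printed "`A_n ≤ λⁿ` … Theorem 4.20 in
  [Grimmett]").
-/

noncomputable section

open Literature.Probability.LatticeModels Literature.Probability.Percolation
  Literature.Probability.RandomPlanarGeometry.SAW

namespace Literature.Barriers.CriticalPhenomena

namespace SupercriticalSAW

variable {δ : ℝ} {u v : Site 2}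

/-! ### The dichotomy: a touched box adjacent to a large untouched connected deep family, or a
walk avoiding every deep box -/

/-- Chains from a base point inside `U` stay inside the set of points chain-reachable from the
base point. [folklore] -/
theorem reflTransGen_filter_of_reflTransGen {U : Finset (Site 2)} {z₀ a : Site 2}
    [DecidablePred fun z => Relation.ReflTransGen (familyStep U) z₀ z]
    (h : Relation.ReflTransGen (familyStep U) z₀ a) :
    Relation.ReflTransGen (familyStep (U.filter fun z => Relation.ReflTransGen (familyStep U) z₀ z))
      z₀ a := by
  induction h with
  | refl => exact Relation.ReflTransGen.refl
  | @tail b c hb hbc ih =>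
    refine ih.tail ⟨hbc.1, ?_, ?_⟩
    · exact Finset.mem_filter.2 ⟨hbc.2.1, hb⟩
    · exact Finset.mem_filter.2 ⟨hbc.2.2, hb.tail hbc⟩

/-- **The geometric core of the proof of Theorem 6 for the disk.** Fix `m` and let
`ξ = ξ(m)` (`tubeRadius`), `0 < δ ≤ 1/(3N)²`. If a walk `γ` of `𝔻_δ` from a site of `𝔻_δ`
leaves a component of `𝔻_δ ∖ Γ_δ^ξ` with more than `s ≥ 0` sites, then EITHER `γ` meets no deep
box, OR there is a connected family `F` of deep boxes, none met by `γ`, with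
`(7N)² |F| > s`, together with a box `B(z₀ + d)` adjacent to a box `B(z₀)` of `F`, not in
`F`, and met by `γ` (the printed "maximal family … the box-distance between the union of boxes
and `γ_δ` is 1", with the hole first pushed `3N` steps inwards so that its boxes are deep, and
the case that `γ_δ` meets no deep box set aside).
[cite: DuminilCopinKozmaYadin2014, §3 (proof of Theorem 6)] -/
theorem good_or_bad_of_hasLargeHole {m : ℕ} (hδ : 0 < δ)
    (hδ' : δ ≤ 1 / (3 * (2 * (m : ℝ) + 2)) ^ 2) {s : ℝ}
    (hs : 0 ≤ s) {γ : DomainSAW unitDisk δ u v} (h : HasLargeHole (tubeRadius m) s γ) :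
    (∀ z ∈ deepBoxes δ m, ∀ t ∈ γ.walk.support, t ∉ mBox m z) ∨
    ∃ F : Finset (Site 2), F ⊆ deepBoxes δ m ∧ IsConnectedFamily F ∧
      s < (7 * (2 * (m : ℝ) + 2)) ^ 2 * F.card ∧
      (∀ z ∈ F, ∀ t ∈ γ.walk.support, t ∉ mBox m z) ∧
      ∃ z₀ ∈ F, ∃ (i : Fin 2) (b : Bool), z₀ + dirVec i b ∉ F ∧
        ∃ t ∈ γ.walk.support, t ∈ mBox m (z₀ + dirVec i b) := by
  classical
  obtain ⟨S, hScard, hSD, hSfar, hSconn⟩ := exists_finset_of_hasLargeHole hδ h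
  -- the family of hole boxes
  set H : Finset (Site 2) := S.image (holeBox m) with hH
  have hHdeep : ∀ z ∈ H, IsDeep δ m z := by
    intro z hz
    obtain ⟨w, hw, rfl⟩ := Finset.mem_image.1 hz
    exact isDeep_holeBox hδ hδ' (hSD w hw)
  have hHunt : ∀ z ∈ H, ∀ t ∈ γ.walk.support, t ∉ mBox m z :=
    holeBox_untouched hSD hSfar fun w hw => isDeep_holeBox hδ hδ' (hSD w hw)
  have hHconn : IsConnectedFamily H := isConnectedFamily_image_holeBox hSconn
  have hHcard : s < (7 * (2 * (m : ℝ) + 2)) ^ 2 * H.card := by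
    have h1 := card_le_mul_card_image_holeBox m S
    have h2 : (S.card : ℝ) ≤ (7 * (2 * (m : ℝ) + 2)) ^ 2 * H.card := by rw [hH]; exact_mod_cast h1
    linarith
  have hSne : S.Nonempty := by
    rw [← Finset.card_pos]
    have : (0 : ℝ) < S.card := hs.trans_lt hScard
    exact_mod_cast this
  obtain ⟨zs, hzs⟩ : H.Nonempty := hSne.image _
  -- the untouched deep boxes and the component of the hole boxes among them
  set U : Finset (Site 2) := (deepBoxes δ m).filter fun z => ∀ t ∈ γ.walk.support, t ∉ mBox m z
    with hU
  have hHU : H ⊆ U := fun z hz =>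
    Finset.mem_filter.2 ⟨(mem_deepBoxes hδ).2 (hHdeep z hz), hHunt z hz⟩
  set F : Finset (Site 2) := U.filter fun z => Relation.ReflTransGen (familyStep U) zs z with hF
  have hFU : F ⊆ U := Finset.filter_subset _ _
  have hHF : H ⊆ F := fun z hz =>
    Finset.mem_filter.2 ⟨hHU hz, familyStep_mono hHU (IsConnectedFamily.reflTransGen hHconn hzs hz)⟩
  have hFdeep : F ⊆ deepBoxes δ m := hFU.trans (Finset.filter_subset _ _)
  have hFunt : ∀ z ∈ F, ∀ t ∈ γ.walk.support, t ∉ mBox m z := fun z hz =>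
    (Finset.mem_filter.1 (hFU hz)).2
  have hFconn : IsConnectedFamily F := by
    rintro ⟨a, ha⟩ ⟨b, hb⟩
    have hzsF : zs ∈ F := hHF hzs
    have ha' := reflTransGen_filter_of_reflTransGen (Finset.mem_filter.1 ha).2
    have hb' := reflTransGen_filter_of_reflTransGen (Finset.mem_filter.1 hb).2
    exact (reachable_induce_of_reflTransGen hzsF ha ha').symm.trans
      (reachable_induce_of_reflTransGen hzsF hb hb')
  have hFcard : s < (7 * (2 * (m : ℝ) + 2)) ^ 2 * F.card := by
    have : (H.card : ℝ) ≤ F.card := by exact_mod_cast Finset.card_le_card hHF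
    nlinarith
  -- the dichotomy
  by_cases hgood : ∃ z₀ ∈ F, ∃ (i : Fin 2) (b : Bool), z₀ + dirVec i b ∈ deepBoxes δ m ∧
      ¬ ∀ t ∈ γ.walk.support, t ∉ mBox m (z₀ + dirVec i b)
  · obtain ⟨z₀, hz₀, i, b, hdeep₁, htouch⟩ := hgood
    refine Or.inr ⟨F, hFdeep, hFconn, hFcard, hFunt, z₀, hz₀, i, b, ?_, ?_⟩
    · exact fun hmem => htouch (hFunt _ hmem)
    · push Not at htouch; exact htouch
  · left
    push Not at hgood
    -- `F` is closed under passing to deep neighbours, hence contains every deep box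
    have hcl : ∀ z, z ∈ F → ∀ (i : Fin 2) (b : Bool), IsDeep δ m (z + dirVec i b) →
        z + dirVec i b ∈ F := by
      intro z hz i b hd
      have hd' : z + dirVec i b ∈ deepBoxes δ m := (mem_deepBoxes hδ).2 hd
      have hU₁ : z + dirVec i b ∈ U := Finset.mem_filter.2 ⟨hd', hgood z hz i b hd'⟩
      refine Finset.mem_filter.2 ⟨hU₁, (Finset.mem_filter.1 hz).2.tail ⟨?_, hFU hz, hU₁⟩⟩
      rw [zdGraph_adj_iff]
      refine ⟨i, ?_⟩
      cases b
      · right; rw [dirVec, add_assoc, ← Pi.single_add]; simp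
      · left; simp [dirVec]
    have hall := forall_isDeep_of_closed hcl (hHF hzs) (hHdeep zs hzs)
    intro z hz
    exact hFunt z (hall z ((mem_deepBoxes hδ).1 hz))


/-! ### Sizes: the disk, holes, and the number of connected families -/

/-- `𝔻_δ` has at most `(2⌈1/δ⌉ + 1)²` sites (`δ > 0`). [folklore] -/
theorem card_meshDomain_unitDisk_le (hδ : 0 < δ) (S : Finset (Site 2))
    (hS : ∀ w ∈ S, w ∈ meshDomain unitDisk δ) : S.card ≤ (2 * ⌈1 / δ⌉₊ + 1) ^ 2 := by
  have hsub : S ⊆ box 2 ⌈1 / δ⌉₊ := by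
    intro w hw
    rw [mem_box]
    intro i
    have h1 := abs_lt_of_mem_meshDomain_unitDisk hδ (hS w hw) i
    have h2 : |((w i : ℤ) : ℝ)| < ((⌈1 / δ⌉₊ : ℕ) : ℝ) := h1.trans_le (Nat.le_ceil _)
    have h3 : |w i| < (⌈1 / δ⌉₊ : ℤ) := by exact_mod_cast h2
    constructor <;> linarith [abs_lt.1 h3]
  exact (Finset.card_le_card hsub).trans (by rw [card_box])

/-- A hole has fewer than `(2⌈1/δ⌉ + 1)²` sites: `HasLargeHole ξ s γ` forces
`s < (2⌈1/δ⌉ + 1)²`. [cite: DuminilCopinKozmaYadin2014, Theorem 6] -/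
theorem lt_of_hasLargeHole (hδ : 0 < δ) {ξ s : ℝ} {γ : DomainSAW unitDisk δ u v}
    (h : HasLargeHole ξ s γ) : s < ((2 * ⌈1 / δ⌉₊ + 1) ^ 2 : ℕ) := by
  obtain ⟨S, hScard, hSD, -, -⟩ := exists_finset_of_hasLargeHole hδ h
  have := card_meshDomain_unitDisk_le hδ S hSD
  exact hScard.trans_le (by exact_mod_cast this)

open Classical in
/-- The connected families of `K` deep boxes containing a given box `z` (the summation index
of the Peierls sum). [cite: DuminilCopinKozmaYadin2014, §3 (proof of Theorem 6: "the number of families of connected boxes of size K")] -/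
def famAt (δ : ℝ) (m : ℕ) (z : Site 2) (K : ℕ) : Finset (Finset (Site 2)) :=
  (deepBoxes δ m).powerset.filter fun F => z ∈ F ∧ F.card = K ∧ IsConnectedFamily F

/-- Membership in `famAt`. [cite: DuminilCopinKozmaYadin2014, §3 (proof of Theorem 6)] -/
theorem mem_famAt {m : ℕ} {z : Site 2} {K : ℕ} {F : Finset (Site 2)} :
    F ∈ famAt δ m z K ↔ F ⊆ deepBoxes δ m ∧ z ∈ F ∧ F.card = K ∧ IsConnectedFamily F := by
  classical
  rw [famAt, Finset.mem_filter, Finset.mem_powerset]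

/-- **Lattice-animal bound**: at most `25^{K-1}` connected families of `K` boxes contain a given
box (`card_connectedFamily_le` with `Δ = 4`: "`A_n ≤ λⁿ`", "up to translation they are
connected subsets of a normalized square lattice"). [cite: DuminilCopinKozmaYadin2014, §3 (proof of Theorem 6)] -/
theorem card_famAt_le (m : ℕ) (z : Site 2) (K : ℕ) : (famAt δ m z K).card ≤ 25 ^ (K - 1) := by
  classical
  -- a site of `ℤ²` has at most four neighbours
  have hΔ : ∀ x : Site 2, ((zdGraph 2).neighborFinset x).card ≤ 4 := by
    intro x
    have hsub : (zdGraph 2).neighborFinset x ⊆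
        (Finset.univ : Finset (Fin 2 × Bool)).image fun p => x + dirVec p.1 p.2 := by
      intro y hy
      rw [SimpleGraph.mem_neighborFinset] at hy
      rw [Finset.mem_image]
      obtain ⟨i, rfl | rfl⟩ := (zdGraph_adj_iff _ _).1 hy
      · exact ⟨(i, true), Finset.mem_univ _, by simp [dirVec]⟩
      · exact ⟨(i, false), Finset.mem_univ _, by rw [dirVec, add_assoc, ← Pi.single_add]; simp⟩
    exact (Finset.card_le_card hsub).trans (Finset.card_image_le.trans (by simp))
  have h := card_connectedFamily_le (R := (zdGraph 2).Adj) (fun x y h => h.symm)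
    (nbr := fun x => (zdGraph 2).neighborFinset x) (Δ := 4) hΔ
    (fun x y h => (SimpleGraph.mem_neighborFinset _ _ _).2 h) z (K - 1) (famAt δ m z K) ?_
  · calc (famAt δ m z K).card ≤ (4 + 1) ^ (2 * (K - 1)) := h
      _ = 25 ^ (K - 1) := by rw [pow_mul]; norm_num
  · intro F hF
    rw [mem_famAt] at hF
    obtain ⟨-, hz, hcard, hconn⟩ := hF
    exact ⟨hz, by omega, fun w hw => IsConnectedFamily.reflTransGen hconn hz hw⟩

end SupercriticalSAW

end Literature.Barriers.CriticalPhenomena
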